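/-
Copyright: cell pub-balaban-gaps, seat ne8 (estimate NE7c), gen 19. Project licence.
-/
import Summits.QuantumFields.BalabanUV.T4Continuum.Spine.NE7c.LiveFactorAdaptiveTreeModel
import Summits.QuantumFields.BalabanUV.T4Continuum.Spine.NE7c.LiveFactorGlobalAdaptiveModel

/-!
# Road (δ) FIRES — BOTH members, (δ-1) and the member OF RECORD — on ADAPTIVE decision trees of print's (2.17)-type tests `|Ū(∂p) − 1| <? ε` of the
# BLOCK-AVERAGED FIELDS `Ū^K = M^K(U)` vs `Ū^{K+1}` of ONE Wilson–Gibbs field: the lattice cells {(δ-1), member of record} × {adaptive tree} ×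
# {consecutive AVERAGING RUNS} of the matrix spanned by files 47 ∕ 48 ∕ 50 ∕ 52, plus the member of record on CONSECUTIVE LATTICES of a torus scheme
# (row NE7c; junction J-29; LATTICE MODEL, [folklore])

Cell `pub-balaban-gaps` (G2), seat ne8, estimate **NE7c** (`T4IndicatorShell.ShellWeightBound`; two-run artefact, NOT PRINTED in [Bałaban 1983–89], NOT
PROVED).  Proof-only file under `Spine/NE7c/`: imports this seat's file 50 `LiveFactorAdaptiveTreeModel` (J-26b: `shellWeightBound_adaptiveTree` — member (δ-1)
on ANY adaptive tree under ANY law, `V = 2(∏_σ(ν_σ+1) − 1)`) and file 52 `LiveFactorGlobalAdaptiveModel` (J-28: `shellWeightBound_globalAdaptiveTree` — the member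
of record, ONE assignment BY LEVEL for every cutoff, per-level constants `V_j = 2(∏_σ(ν_{j,σ}+1) − 1)`); through them this seat's files 10 `LiveFactorGlobalLevels` ∕ 11 `LiveFactorGlobalCompact` (window arithmetic, §4) and the tree's
`T4ShellMeasure`, `T4GenFunBounds.gibbsMeasure`, `Setup.Averaging`, `Missing.measurable_plaqHol`, `RegularGaugeGroup.measurable_dist1`.  Nothing of Bałaban's is named beyond the
DEFINITIONS `Setup.Averaging` ∕ `Averaging.iter` ([B7] (15), [B12] (0.4)∕(0.11)), `GaugeField.plaqHol`, `GaugeGroup.dist1 = |· − 1|` ([B7] (19)); no `def`;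
classical decidability; 0 `sorry`.  The measurability of the iterate `Averaging.iter av k` is taken as the hypothesis `hiter` (discharged for every family
with measurable steps by file 48's `LiveFactorAveragedRunsModel.measurable_iter`, BY NAME; file 48 is not imported).

THE QUESTION (file 48 fired member (δ-1) on the laws of `Ū^K` ∕ `Ū^{K+1}` with a FIXED battery of `1 − Re tr` tests; files 50 ∕ 52 fired (δ-1) ∕ the member of
record on ADAPTIVE trees under any law, instanced on CONSECUTIVE LATTICES of a torus scheme at level 0).  Do both members fire on the pair of laws NE7c
actually compares — «`K` averaging steps» vs «`K + 1` averaging steps» of ONE interacting field ([B12] (0.11)∕(0.21) in the push-forward reading) — when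
each run books print's small-field tests `|Ū(∂p) − 1| <? θ·λ` ([B14] (2.17) at the run's own averaged field, WITHOUT the minimiser `U_{k,□}(V_k)`) through ITS
OWN ADAPTIVE TREE (e.g. «test the plaquettes of the blocks not yet declared large» — any history-dependent rule)?

ANSWER ([folklore]): yes, by instantiation.
* §1 **`shellWeightBound_averagedRuns_adaptiveTree`** — member (δ-1) (one live factor `(1 − c₁ϑ^K)^{i⋆K}` per comparison): file 50's
  `shellWeightBound_adaptiveTree` at `P^A_K = (gibbsMeasure Pm β).map (iter av K)`, `P^B_K = (gibbsMeasure Pm β).map (iter av (K+1))`, observables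
  `dist1 (Ū(∂p^X_{K,t}))`; conclusion: ONE common index per `K` below `⌊β′∕(c₁ϑ^K)⌋₊`, both laws' chosen booked-shell mass `≤ ((2∏_σ(ν_σ+1) − 2)·4c₁∕β′)·ϑ^K`,
  and `T4IndicatorShell.ShellWeightBound` BY NAME.
* §2 **`shellWeightBound_averagedRuns_globalAdaptiveTree`** — the member OF RECORD (δ-global-compact): file 52's `shellWeightBound_globalAdaptiveTree` at the
  same laws and observables, levels `lev^X K t ∈ W K`, radii `2ρ^X ≤ ρ⋆_{lev}`; conclusion: ONE global assignment `c` (`c j < n_j`) and `ShellWeightBound` with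
  `Wsh K` = the two laws' total booked-shell mass at `c`; LEFT as hypotheses, verbatim from file 11 ∕ 52, the WINDOW BOOKKEEPING (`n_j`, `W K` ∕ `B j`, loss
  factors `t_j`, majorant `Σ_{j∈W K} t_j·(2·#B_j·V_j∕n_j) ≤ C·ϑ^K`).
* §4 **`shellWeightBound_averagedRuns_globalAdaptiveTree_of_rate`** — §2 with the window bookkeeping DISCHARGED BY NAME from files 10 ∕ 11's arithmetic: live
  window `W K = [K − N₁, K]` ((W1); `LiveFactorGlobalLevels.window_books` ∕ `card_books`), geometric loss factors `t_j = (1 − η)⁻¹η^{−j}`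
  (`LiveFactorGlobalCompact.geomLoss_pos` ∕ `geomLoss_sum_inv_lt_one`) and ONE rate hypothesis `2(N₁+1)·V_j∕n_j ≤ M·ϑ^j`, `0 < ϑ < η < 1`
  (`window_sum_le_geometric_weighted`, majorant at rate `ϑ∕η`): the member of record at the lattice instance with NO bookkeeping hypothesis left — the same
  footing as (δ-1) in §1 ((R) + (W1) + a rate).
* §3 **`shellWeightBound_wilsonScheme_globalAdaptiveTree`** — the member of record on CONSECUTIVE LATTICES of ANY torus scheme (Wilson–Gibbs at level 0, `β_K ≥ 0`,
  tests `dist1 (U(∂q))`): the companion of file 50 §5 that file 52 left uninstanced — so that BOTH columns {consecutive lattices, consecutive averaging runs} of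
  the matrix are closed for both members.
Probability of the push-forwards: `Measure.isProbabilityMeasure_map`; measurability of the tests: `RegularGaugeGroup.measurable_dist1 ∘ Missing.measurable_plaqHol`.

WHAT THIS SHOWS ∕ DOES NOT SHOW (honest).  SHOWS: on the closest lattice objects the tree has to [B14] (2.17)–(2.18) at `k = 0` without the minimiser — the
laws of Bałaban's averaged fields of one Wilson–Gibbs field, print's classifier `|·(∂p) − 1|`, an ARBITRARY adaptive booking rule per run — BOTH members of
road (δ) deliver `T4IndicatorShell.ShellWeightBound` BY NAME by σ-additivity and the cascade count alone ((δ-1) outright with its explicit ceiling; the member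
of record modulo the window bookkeeping).  DOES NOT SHOW: that the tree IS Bałaban's ([B14] (2.18)'s admissible sequences of domains over the minimisers —
node O), the window bookkeeping ((W1) ∕ U1b data), (L1-step), two-run closeness (the radii `ρ^X` are free).  BY-NAME EFFECT ON THE WALL: none (MODEL).
VERDICT WORD UNCHANGED: WORK-bound behind node O; INSTANCE 0∕1.  NE7c ∕ NE7b NOT PRINTED ∕ NOT PROVED; spine 0∕9; one finite T⁴ — NOT ℝ⁴, NOT infinite
volume, NOT the mass gap, NOT Clay.  HONEST DEPENDENCY (cell): continuum YM on T⁴ ⇐ BetaPertH ∧ nine spine estimates (0∕9 proved); BetaPertH ⇐ (D1) ∧ (D4)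
∧ CAP+tail.
-/

set_option autoImplicit false

noncomputable section

open MeasureTheory Finset Set
open scoped Classical
open Literature.MathematicalPhysics.QuantumFieldTheory.Balaban1983to89
open Literature.MathematicalPhysics.QuantumFieldTheory.Balaban1983to89.T4ShellMeasure
open Summit.QuantumFields.BalabanUV.T4Continuum.Spine.NE7c.LiveFactorAdaptiveTreeModel (shellWeightBound_adaptiveTree)
open Summit.QuantumFields.BalabanUV.T4Continuum.Spine.NE7c.LiveFactorGlobalAdaptiveModel (shellWeightBound_globalAdaptiveTree)
open Summit.QuantumFields.BalabanUV.T4Continuum.Spine.NE7c.LiveFactorGlobalLevels (window_books card_books)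
open Summit.QuantumFields.BalabanUV.T4Continuum.Spine.NE7c.LiveFactorGlobalCompact (geomLoss_pos geomLoss_sum_inv_lt_one window_sum_le_geometric_weighted)

namespace Summit.QuantumFields.BalabanUV.T4Continuum.Spine.NE7c.LiveFactorAveragedRunsGlobalAdaptiveModel

section Averaged

variable {G : Type*} [GaugeGroup G] [MeasurableSpace G] [RegularGaugeGroup G] [HaarData G] {Pm : Params} (av : ∀ j, Averaging Pm j G) (β : ℝ)
  {α τ : Type*} [DecidableEq α] [Fintype τ] [DecidableEq τ] {S : ℕ}
  (pA : ∀ K, τ → Plaq Pm K) (pB : ∀ K, τ → Plaq Pm (K + 1)) (θ ρA ρB : ℕ → τ → ℝ)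
  (testsA testsB : ℕ → ℕ → α → Finset τ) (nextA nextB : ℕ → ℕ → α → Finset τ → α) (aA aB : ℕ → α)

/-! ## §1 Member (δ-1) on adaptive trees of (2.17)-type tests of the averaged fields `Ū^K` vs `Ū^{K+1}` -/

section DeltaOne

variable (ν : ℕ → ℕ)

/-- **MEMBER (δ-1) FIRES ON ADAPTIVE TREES OF PRINT's (2.17)-TYPE TESTS OF THE AVERAGED FIELDS OF ONE WILSON–GIBBS FIELD.**  `G` any regular gauge group, `Pm`
any torus parameters, `β ≥ 0`, ONE field under `T4GenFunBounds.gibbsMeasure Pm β`; `av` ANY family of Bałaban block averagings whose iterates are measurable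
(`hiter`; file 48's `measurable_iter` for measurable steps).  Comparison `K`: run A = the LAW of `Ū^K = Averaging.iter av K U` on `GaugeField Pm K G`, run B = the
law of `Ū^{K+1}`; label `t ∈ τ` tests `|Ū(∂p^X_{K,t}) − 1|` (`GaugeGroup.dist1`, [B7] (19); [B14] (2.17)'s classifier without the minimiser) against
`θ_{K,t}·(1 − c₁ϑ^K)^i`, radii `0 ≤ ρ^X_{K,t}`, `2ρ^X_{K,t} ≤ c₁ϑ^K` (`0 < c₁`, `2c₁ ≤ β′ ≤ 1`, `0 < ϑ < 1`); each run books through ITS OWN ADAPTIVE TREE at most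
`ν_σ` tests at stage `σ < S`.  Conclusion = file 50's `shellWeightBound_adaptiveTree` BY NAME: ONE common live-factor index `i⋆ K < ⌊β′∕(c₁ϑ^K)⌋₊` per `K`, both
laws' chosen booked-shell mass `≤ ((2∏_{σ<S}(ν_σ+1) − 2)·4c₁∕β′)·ϑ^K`, and `T4IndicatorShell.ShellWeightBound`.  MODEL: the trees are ARBITRARY (node O). [folklore] -/
theorem shellWeightBound_averagedRuns_adaptiveTree (hβ : 0 ≤ β) (hiter : ∀ k, Measurable (Averaging.iter av k)) (l₀ : ℝ) {c₁ β' ϑ : ℝ} (hc₁ : 0 < c₁)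
    (h2 : 2 * c₁ ≤ β') (hβ1 : β' ≤ 1) (hϑ0 : 0 < ϑ) (hϑ1 : ϑ < 1) (hθ : ∀ K t, 0 ≤ θ K t)
    (hA0 : ∀ K t, 0 ≤ ρA K t) (hA2 : ∀ K t, 2 * ρA K t ≤ c₁ * ϑ ^ K) (hB0 : ∀ K t, 0 ≤ ρB K t) (hB2 : ∀ K t, 2 * ρB K t ≤ c₁ * ϑ ^ K)
    (hνA : ∀ K σ a, (testsA K σ a).card ≤ ν σ) (hνB : ∀ K σ a, (testsB K σ a).card ≤ ν σ) :
    ∃ istar : ℕ → ℕ, (∀ K, istar K < ⌊β' / (c₁ * ϑ ^ K)⌋₊ ∧ ∑ p : Fin S × τ, ∑ ω : τ → Bool, ((T4GenFunBounds.gibbsMeasure (G := G) Pm β).map (Averaging.iter av K)).real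
        ((⋂ t, (fun U : GaugeField Pm K G => dist1 (GaugeField.plaqHol U (pA K t))) ⁻¹' (if ω t then Iio (θ K t * (1 - c₁ * ϑ ^ K) ^ istar K) else Ici (θ K t * (1 - c₁ * ϑ
        ^ K) ^ istar K))) ∩ {x | p.2 ∈ testsA K p.1 (Nat.rec (motive := fun _ => α) (aA K) (fun σ a => nextA K σ a ((testsA K σ a).filter fun t => ω t = true)) p.1) ∧ (fun
        U : GaugeField Pm K G => dist1 (GaugeField.plaqHol U (pA K p.2))) x ∈ twoSidedShell (θ K p.2) (c₁ * ϑ ^ K) (ρA K p.2) (istar K)}) ≤ (((2 * ∏ σ ∈ range S, (ν σ + 1)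
        - 2 : ℕ) : ℝ) * (4 * c₁ / β')) * ϑ ^ K ∧ ∑ p : Fin S × τ, ∑ ω : τ → Bool, ((T4GenFunBounds.gibbsMeasure (G := G) Pm β).map (Averaging.iter av (K + 1))).real ((⋂ t,
        (fun U : GaugeField Pm (K + 1) G => dist1 (GaugeField.plaqHol U (pB K t))) ⁻¹' (if ω t then Iio (θ K t * (1 - c₁ * ϑ ^ K) ^ istar K) else Ici (θ K t * (1 - c₁ * ϑ ^
        K) ^ istar K))) ∩ {x | p.2 ∈ testsB K p.1 (Nat.rec (motive := fun _ => α) (aB K) (fun σ a => nextB K σ a ((testsB K σ a).filter fun t => ω t = true)) p.1) ∧ (fun U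
        : GaugeField Pm (K + 1) G => dist1 (GaugeField.plaqHol U (pB K p.2))) x ∈ twoSidedShell (θ K p.2) (c₁ * ϑ ^ K) (ρB K p.2) (istar K)}) ≤ (((2 * ∏ σ ∈ range S, (ν σ +
        1) - 2 : ℕ) : ℝ) * (4 * c₁ / β')) * ϑ ^ K) ∧ T4IndicatorShell.ShellWeightBound l₀ (fun _ => (univ : Finset (τ → Bool))) (fun K (_ : ℝ) (ω : τ → Bool) =>
        ((T4GenFunBounds.gibbsMeasure (G := G) Pm β).map (Averaging.iter av K)).real (⋂ t, (fun U : GaugeField Pm K G => dist1 (GaugeField.plaqHol U (pA K t))) ⁻¹' (if ω t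
        then Iio (θ K t * (1 - c₁ * ϑ ^ K) ^ istar K) else Ici (θ K t * (1 - c₁ * ϑ ^ K) ^ istar K)))) (fun K (_ : ℝ) (ω : τ → Bool) => ((T4GenFunBounds.gibbsMeasure (G :=
        G) Pm β).map (Averaging.iter av (K + 1))).real (⋂ t, (fun U : GaugeField Pm (K + 1) G => dist1 (GaugeField.plaqHol U (pB K t))) ⁻¹' (if ω t then Iio (θ K t * (1 -
        c₁ * ϑ ^ K) ^ istar K) else Ici (θ K t * (1 - c₁ * ϑ ^ K) ^ istar K)))) (fun K (_ : ℝ) (ω : τ → Bool) => ((T4GenFunBounds.gibbsMeasure (G := G) Pm β).map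
        (Averaging.iter av K)).real ((⋂ t, (fun U : GaugeField Pm K G => dist1 (GaugeField.plaqHol U (pA K t))) ⁻¹' (if ω t then Iio (θ K t * (1 - c₁ * ϑ ^ K) ^ istar K)
        else Ici (θ K t * (1 - c₁ * ϑ ^ K) ^ istar K))) ∩ ⋃ p : Fin S × τ, {x | p.2 ∈ testsA K p.1 (Nat.rec (motive := fun _ => α) (aA K) (fun σ a => nextA K σ a ((testsA K
        σ a).filter fun t => ω t = true)) p.1) ∧ (fun U : GaugeField Pm K G => dist1 (GaugeField.plaqHol U (pA K p.2))) x ∈ twoSidedShell (θ K p.2) (c₁ * ϑ ^ K) (ρA K p.2)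
        (istar K)})) (fun K (_ : ℝ) (ω : τ → Bool) => ((T4GenFunBounds.gibbsMeasure (G := G) Pm β).map (Averaging.iter av (K + 1))).real ((⋂ t, (fun U : GaugeField Pm (K +
        1) G => dist1 (GaugeField.plaqHol U (pB K t))) ⁻¹' (if ω t then Iio (θ K t * (1 - c₁ * ϑ ^ K) ^ istar K) else Ici (θ K t * (1 - c₁ * ϑ ^ K) ^ istar K))) ∩ ⋃ p : Fin
        S × τ, {x | p.2 ∈ testsB K p.1 (Nat.rec (motive := fun _ => α) (aB K) (fun σ a => nextB K σ a ((testsB K σ a).filter fun t => ω t = true)) p.1) ∧ (fun U :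
        GaugeField Pm (K + 1) G => dist1 (GaugeField.plaqHol U (pB K p.2))) x ∈ twoSidedShell (θ K p.2) (c₁ * ϑ ^ K) (ρB K p.2) (istar K)})) (fun K => ∑ p : Fin S × τ, ∑ ω
        : τ → Bool, ((T4GenFunBounds.gibbsMeasure (G := G) Pm β).map (Averaging.iter av K)).real ((⋂ t, (fun U : GaugeField Pm K G => dist1 (GaugeField.plaqHol U (pA K t)))
        ⁻¹' (if ω t then Iio (θ K t * (1 - c₁ * ϑ ^ K) ^ istar K) else Ici (θ K t * (1 - c₁ * ϑ ^ K) ^ istar K))) ∩ {x | p.2 ∈ testsA K p.1 (Nat.rec (motive := fun _ => α)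
        (aA K) (fun σ a => nextA K σ a ((testsA K σ a).filter fun t => ω t = true)) p.1) ∧ (fun U : GaugeField Pm K G => dist1 (GaugeField.plaqHol U (pA K p.2))) x ∈
        twoSidedShell (θ K p.2) (c₁ * ϑ ^ K) (ρA K p.2) (istar K)}) + ∑ p : Fin S × τ, ∑ ω : τ → Bool, ((T4GenFunBounds.gibbsMeasure (G := G) Pm β).map (Averaging.iter av
        (K + 1))).real ((⋂ t, (fun U : GaugeField Pm (K + 1) G => dist1 (GaugeField.plaqHol U (pB K t))) ⁻¹' (if ω t then Iio (θ K t * (1 - c₁ * ϑ ^ K) ^ istar K) else Ici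
        (θ K t * (1 - c₁ * ϑ ^ K) ^ istar K))) ∩ {x | p.2 ∈ testsB K p.1 (Nat.rec (motive := fun _ => α) (aB K) (fun σ a => nextB K σ a ((testsB K σ a).filter fun t => ω t
        = true)) p.1) ∧ (fun U : GaugeField Pm (K + 1) G => dist1 (GaugeField.plaqHol U (pB K p.2))) x ∈ twoSidedShell (θ K p.2) (c₁ * ϑ ^ K) (ρB K p.2) (istar K)}))  := by
  haveI : IsProbabilityMeasure (T4GenFunBounds.gibbsMeasure (G := G) Pm β) := T4GenFunBounds.isProbabilityMeasure_gibbsMeasure _ hβ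
  haveI hI : ∀ K, IsProbabilityMeasure ((T4GenFunBounds.gibbsMeasure (G := G) Pm β).map (Averaging.iter av K)) :=
    fun K => Measure.isProbabilityMeasure_map (hiter K).aemeasurable
  haveI : ∀ K, IsProbabilityMeasure ((T4GenFunBounds.gibbsMeasure (G := G) Pm β).map (Averaging.iter av (K + 1))) := fun K => hI (K + 1)
  exact shellWeightBound_adaptiveTree (ΩA := fun K => GaugeField Pm K G) (ΩB := fun K => GaugeField Pm (K + 1) G)
    (fun K => (T4GenFunBounds.gibbsMeasure (G := G) Pm β).map (Averaging.iter av K))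
    (fun K => (T4GenFunBounds.gibbsMeasure (G := G) Pm β).map (Averaging.iter av (K + 1)))
    (fun K t (U : GaugeField Pm K G) => dist1 (GaugeField.plaqHol U (pA K t)))
    (fun K t (U : GaugeField Pm (K + 1) G) => dist1 (GaugeField.plaqHol U (pB K t))) θ ρA ρB testsA testsB nextA nextB aA aB ν
    l₀ hc₁ h2 hβ1 hϑ0 hϑ1
    (fun K t => RegularGaugeGroup.measurable_dist1.comp (Missing.measurable_plaqHol (pA K t)))
    (fun K t => RegularGaugeGroup.measurable_dist1.comp (Missing.measurable_plaqHol (pB K t))) hθ hA0 hA2 hB0 hB2 hνA hνB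

end DeltaOne

/-! ## §2 The member OF RECORD (δ-global-compact) on adaptive trees of (2.17)-type tests of the averaged fields `Ū^K` vs `Ū^{K+1}` -/

section Record

variable (ρs : ℕ → ℝ) (levA levB : ℕ → τ → ℕ) (ν : ℕ → ℕ → ℕ)

/-- **THE MEMBER OF RECORD (δ-global-compact) FIRES ON ADAPTIVE TREES OF PRINT's (2.17)-TYPE TESTS OF THE AVERAGED FIELDS OF ONE WILSON–GIBBS FIELD.**
Same two laws and observables as §1; level `lev^X K t ∈ W K` of each test, thresholds `θ_{K,t}·(1 − ρ⋆_{lev})^{c(lev)}` under ONE global assignment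
`c : ℕ → ℕ` by level, radii `0 ≤ ρ^X_{K,t}`, `2ρ^X_{K,t} ≤ ρ⋆_{lev}`, `0 ≤ ρ⋆_j ≤ 1`; each run's OWN adaptive tree books at most `ν_{j,σ}` level-`j` tests at
stage `σ < S`.  Conclusion = file 52's `shellWeightBound_globalAdaptiveTree` BY NAME: ONE global `c` (`c j < n_j`) and `T4IndicatorShell.ShellWeightBound`
with `Wsh K` = the two laws' total booked-shell mass at `c`; left as hypotheses exactly file 11's window bookkeeping (`n_j`, `W K` ∕ `B j`, `t_j` with
`Σ_{j<J} t_j⁻¹ < 1`, `Σ_{j∈W K} t_j·(2·#B_j·V_j∕n_j) ≤ C·ϑ^K`).  MODEL: the trees are ARBITRARY (node O). [folklore] -/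
theorem shellWeightBound_averagedRuns_globalAdaptiveTree (hβ : 0 ≤ β) (hiter : ∀ k, Measurable (Averaging.iter av k)) (l₀ : ℝ) {C ϑ : ℝ}
    (n : ℕ → ℕ) (hn : ∀ j, 0 < n j) (B W : ℕ → Finset ℕ) (hWB : ∀ K j, j ∈ W K → K ∈ B j) (hθ : ∀ K t, 0 ≤ θ K t) (hs0 : ∀ j, 0 ≤ ρs j)
    (hs1 : ∀ j, ρs j ≤ 1) (hA0 : ∀ K t, 0 ≤ ρA K t) (hA2 : ∀ K t, 2 * ρA K t ≤ ρs (levA K t)) (hB0 : ∀ K t, 0 ≤ ρB K t)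
    (hB2 : ∀ K t, 2 * ρB K t ≤ ρs (levB K t)) (hlevA : ∀ K t, levA K t ∈ W K) (hlevB : ∀ K t, levB K t ∈ W K)
    (hνA : ∀ K j σ a, ((testsA K σ a).filter fun t => levA K t = j).card ≤ ν j σ)
    (hνB : ∀ K j σ a, ((testsB K σ a).filter fun t => levB K t = j).card ≤ ν j σ)
    (tl : ℕ → ℝ) (htl0 : ∀ j, 0 < tl j) (htl : ∀ J, ∑ j ∈ range J, (tl j)⁻¹ < 1) (hϑ0 : 0 ≤ ϑ) (hϑ1 : ϑ < 1)
    (hgeo : ∀ K, ∑ j ∈ W K, tl j * (2 * ((B j).card : ℝ) * (((2 * ∏ σ ∈ range S, (ν j σ + 1) - 2 : ℕ) : ℝ)) / n j) ≤ C * ϑ ^ K) :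
    ∃ c : ℕ → ℕ, (∀ j, c j < n j) ∧
      T4IndicatorShell.ShellWeightBound l₀ (fun _ => (univ : Finset (τ → Bool)))
        (fun K (_ : ℝ) (ω : τ → Bool) => ((T4GenFunBounds.gibbsMeasure (G := G) Pm β).map (Averaging.iter av K)).real (⋂ t, (fun V : GaugeField Pm K G => dist1 (GaugeField.plaqHol V (pA K t))) ⁻¹' (if ω t then Iio (θ K t * (1 - ρs (levA K t)) ^ c (levA K t)) else Ici (θ K t * (1 - ρs (levA K t)) ^ c (levA K t)))))
        (fun K (_ : ℝ) (ω : τ → Bool) => ((T4GenFunBounds.gibbsMeasure (G := G) Pm β).map (Averaging.iter av (K + 1))).real (⋂ t, (fun V : GaugeField Pm (K + 1) G => dist1 (GaugeField.plaqHol V (pB K t))) ⁻¹' (if ω t then Iio (θ K t * (1 - ρs (levB K t)) ^ c (levB K t)) else Ici (θ K t * (1 - ρs (levB K t)) ^ c (levB K t)))))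
        (fun K (_ : ℝ) (ω : τ → Bool) => ((T4GenFunBounds.gibbsMeasure (G := G) Pm β).map (Averaging.iter av K)).real ((⋂ t, (fun V : GaugeField Pm K G => dist1 (GaugeField.plaqHol V (pA K t))) ⁻¹' (if ω t then Iio (θ K t * (1 - ρs (levA K t)) ^ c (levA K t)) else Ici (θ K t * (1 - ρs (levA K t)) ^ c (levA K t)))) ∩ ⋃ p : Fin S × τ, {x | p.2 ∈ testsA K p.1 (Nat.rec (motive := fun _ => α) (aA K) (fun σ a => nextA K σ a ((testsA K σ a).filter fun t => ω t = true)) p.1) ∧ dist1 (GaugeField.plaqHol x (pA K p.2)) ∈ twoSidedShell (θ K p.2) (ρs (levA K p.2)) (ρA K p.2) (c (levA K p.2))}))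
        (fun K (_ : ℝ) (ω : τ → Bool) => ((T4GenFunBounds.gibbsMeasure (G := G) Pm β).map (Averaging.iter av (K + 1))).real ((⋂ t, (fun V : GaugeField Pm (K + 1) G => dist1 (GaugeField.plaqHol V (pB K t))) ⁻¹' (if ω t then Iio (θ K t * (1 - ρs (levB K t)) ^ c (levB K t)) else Ici (θ K t * (1 - ρs (levB K t)) ^ c (levB K t)))) ∩ ⋃ p : Fin S × τ, {x | p.2 ∈ testsB K p.1 (Nat.rec (motive := fun _ => α) (aB K) (fun σ a => nextB K σ a ((testsB K σ a).filter fun t => ω t = true)) p.1) ∧ dist1 (GaugeField.plaqHol x (pB K p.2)) ∈ twoSidedShell (θ K p.2) (ρs (levB K p.2)) (ρB K p.2) (c (levB K p.2))}))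
        (fun K => ∑ p : Fin S × τ, ∑ ω : τ → Bool, ((T4GenFunBounds.gibbsMeasure (G := G) Pm β).map (Averaging.iter av K)).real ((⋂ t, (fun V : GaugeField Pm K G => dist1 (GaugeField.plaqHol V (pA K t))) ⁻¹' (if ω t then Iio (θ K t * (1 - ρs (levA K t)) ^ c (levA K t)) else Ici (θ K t * (1 - ρs (levA K t)) ^ c (levA K t)))) ∩ {x | p.2 ∈ testsA K p.1 (Nat.rec (motive := fun _ => α) (aA K) (fun σ a => nextA K σ a ((testsA K σ a).filter fun t => ω t = true)) p.1) ∧ dist1 (GaugeField.plaqHol x (pA K p.2)) ∈ twoSidedShell (θ K p.2) (ρs (levA K p.2)) (ρA K p.2) (c (levA K p.2))}) + ∑ p : Fin S × τ, ∑ ω : τ → Bool, ((T4GenFunBounds.gibbsMeasure (G := G) Pm β).map (Averaging.iter av (K + 1))).real ((⋂ t,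
                (fun V : GaugeField Pm (K + 1) G => dist1 (GaugeField.plaqHol V (pB K t))) ⁻¹' (if ω t then Iio (θ K t * (1 - ρs (levB K t)) ^ c (levB K t)) else Ici (θ K t * (1 - ρs (levB K t)) ^ c (levB K t)))) ∩ {x | p.2 ∈ testsB K p.1
                (Nat.rec (motive := fun _ => α) (aB K) (fun σ a => nextB K σ a ((testsB K σ a).filter fun t => ω t = true)) p.1) ∧ dist1 (GaugeField.plaqHol x (pB K p.2)) ∈ twoSidedShell (θ K p.2) (ρs
                (levB K p.2)) (ρB K p.2) (c (levB K p.2))}))  := by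
  haveI : IsProbabilityMeasure (T4GenFunBounds.gibbsMeasure (G := G) Pm β) := T4GenFunBounds.isProbabilityMeasure_gibbsMeasure _ hβ
  haveI hI : ∀ K, IsProbabilityMeasure ((T4GenFunBounds.gibbsMeasure (G := G) Pm β).map (Averaging.iter av K)) :=
    fun K => Measure.isProbabilityMeasure_map (hiter K).aemeasurable
  haveI : ∀ K, IsProbabilityMeasure ((T4GenFunBounds.gibbsMeasure (G := G) Pm β).map (Averaging.iter av (K + 1))) := fun K => hI (K + 1)
  exact shellWeightBound_globalAdaptiveTree (S := S) (ΩA := fun K => GaugeField Pm K G) (ΩB := fun K => GaugeField Pm (K + 1) G)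
    (fun K => (T4GenFunBounds.gibbsMeasure (G := G) Pm β).map (Averaging.iter av K))
    (fun K => (T4GenFunBounds.gibbsMeasure (G := G) Pm β).map (Averaging.iter av (K + 1)))
    (fun K t (V : GaugeField Pm K G) => dist1 (GaugeField.plaqHol V (pA K t)))
    (fun K t (V : GaugeField Pm (K + 1) G) => dist1 (GaugeField.plaqHol V (pB K t))) θ ρA ρB ρs levA levB testsA testsB nextA nextB aA aB ν
    l₀ n hn B W hWB
    (fun K t => RegularGaugeGroup.measurable_dist1.comp (Missing.measurable_plaqHol (pA K t)))
    (fun K t => RegularGaugeGroup.measurable_dist1.comp (Missing.measurable_plaqHol (pB K t)))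
    hθ hs0 hs1 hA0 hA2 hB0 hB2 hlevA hlevB hνA hνB tl htl0 htl hϑ0 hϑ1 hgeo

end Record

/-! ## §4 The member OF RECORD on the averaged runs with the WINDOW BOOKKEEPING DISCHARGED: bounded live window `[K − N₁, K]` (W1), geometric loss
factors, level budgets at a rate — files 10 ∕ 11's arithmetic BY NAME -/

section Rate

variable (ρs : ℕ → ℝ) (levA levB : ℕ → τ → ℕ) (ν : ℕ → ℕ → ℕ)

/-- **THE MEMBER OF RECORD ON THE AVERAGED RUNS, RATE FORM — NO window-bookkeeping hypothesis left.**  As §2, with the bookkeeping of file 11 INSTANTIATED and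
DISCHARGED: live window `W K = [K − N₁, K]` (reading (W1): every test booked at comparison `K` has level `K − N₁ ≤ lev ≤ K`), hence `B j = [j, j + N₁]`,
`#B j = N₁ + 1` (file 10 `window_books` ∕ `card_books`); geometric loss factors `t_j = (1 − η)⁻¹η^{−j}` with `Σ_{j<J} t_j⁻¹ = 1 − η^J < 1` (file 11 `geomLoss_pos` ∕
`geomLoss_sum_inv_lt_one`); and ONE rate hypothesis on the level budgets, `2(N₁ + 1)·V_j ∕ n_j ≤ M·ϑ^j` with `0 < ϑ < η < 1` (the candidate counts `n_j` grow
like the inverse two-run closeness `ρ_j⁻¹ ≳ ϑ^{−j}` — node U1b's rate, here a hypothesis on `n`), which gives file 11's majorant at rate `ϑ∕η` (file 11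
`window_sum_le_geometric_weighted`).  Conclusion: ONE global assignment `c` (`c j < n_j`) and `T4IndicatorShell.ShellWeightBound` for the two laws of §2 with
`Wsh K` = their total booked-shell mass at `c` — the member of record at the lattice instance on the same hypothesis footing as (δ-1) in §1 ((R) + (W1) + a
rate).  MODEL: the trees are ARBITRARY (node O). [folklore] -/
theorem shellWeightBound_averagedRuns_globalAdaptiveTree_of_rate (hβ : 0 ≤ β) (hiter : ∀ k, Measurable (Averaging.iter av k)) (l₀ : ℝ) (N₁ : ℕ)
    {ϑ η M : ℝ} (hϑ0 : 0 < ϑ) (hϑη : ϑ < η) (hη1 : η < 1) (hM : 0 ≤ M) (n : ℕ → ℕ) (hn : ∀ j, 0 < n j)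
    (he : ∀ j, 2 * ((N₁ : ℝ) + 1) * (((2 * ∏ σ ∈ range S, (ν j σ + 1) - 2 : ℕ) : ℝ)) / n j ≤ M * ϑ ^ j)
    (hθ : ∀ K t, 0 ≤ θ K t) (hs0 : ∀ j, 0 ≤ ρs j) (hs1 : ∀ j, ρs j ≤ 1)
    (hA0 : ∀ K t, 0 ≤ ρA K t) (hA2 : ∀ K t, 2 * ρA K t ≤ ρs (levA K t)) (hB0 : ∀ K t, 0 ≤ ρB K t) (hB2 : ∀ K t, 2 * ρB K t ≤ ρs (levB K t))
    (hlevA : ∀ K t, levA K t ∈ Finset.Icc (K - N₁) K) (hlevB : ∀ K t, levB K t ∈ Finset.Icc (K - N₁) K)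
    (hνA : ∀ K j σ a, ((testsA K σ a).filter fun t => levA K t = j).card ≤ ν j σ)
    (hνB : ∀ K j σ a, ((testsB K σ a).filter fun t => levB K t = j).card ≤ ν j σ) :
    ∃ c : ℕ → ℕ, (∀ j, c j < n j) ∧
      T4IndicatorShell.ShellWeightBound l₀ (fun _ => (univ : Finset (τ → Bool)))
        (fun K (_ : ℝ) (ω : τ → Bool) => ((T4GenFunBounds.gibbsMeasure (G := G) Pm β).map (Averaging.iter av K)).real (⋂ t, (fun V : GaugeField Pm K G => dist1 (GaugeField.plaqHol V (pA K t))) ⁻¹' (if ω t then Iio (θ K t * (1 - ρs (levA K t)) ^ c (levA K t)) else Ici (θ K t * (1 - ρs (levA K t)) ^ c (levA K t)))))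
        (fun K (_ : ℝ) (ω : τ → Bool) => ((T4GenFunBounds.gibbsMeasure (G := G) Pm β).map (Averaging.iter av (K + 1))).real (⋂ t, (fun V : GaugeField Pm (K + 1) G => dist1 (GaugeField.plaqHol V (pB K t))) ⁻¹' (if ω t then Iio (θ K t * (1 - ρs (levB K t)) ^ c (levB K t)) else Ici (θ K t * (1 - ρs (levB K t)) ^ c (levB K t)))))
        (fun K (_ : ℝ) (ω : τ → Bool) => ((T4GenFunBounds.gibbsMeasure (G := G) Pm β).map (Averaging.iter av K)).real ((⋂ t, (fun V : GaugeField Pm K G => dist1 (GaugeField.plaqHol V (pA K t))) ⁻¹' (if ω t then Iio (θ K t * (1 - ρs (levA K t)) ^ c (levA K t)) else Ici (θ K t * (1 - ρs (levA K t)) ^ c (levA K t)))) ∩ ⋃ p : Fin S × τ, {x | p.2 ∈ testsA K p.1 (Nat.rec (motive := fun _ => α) (aA K) (fun σ a => nextA K σ a ((testsA K σ a).filter fun t => ω t = true)) p.1) ∧ dist1 (GaugeField.plaqHol x (pA K p.2)) ∈ twoSidedShell (θ K p.2) (ρs (levA K p.2)) (ρA K p.2) (c (levA K p.2))}))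
        (fun K (_ : ℝ) (ω : τ → Bool) => ((T4GenFunBounds.gibbsMeasure (G := G) Pm β).map (Averaging.iter av (K + 1))).real ((⋂ t, (fun V : GaugeField Pm (K + 1) G => dist1 (GaugeField.plaqHol V (pB K t))) ⁻¹' (if ω t then Iio (θ K t * (1 - ρs (levB K t)) ^ c (levB K t)) else Ici (θ K t * (1 - ρs (levB K t)) ^ c (levB K t)))) ∩ ⋃ p : Fin S × τ, {x | p.2 ∈ testsB K p.1 (Nat.rec (motive := fun _ => α) (aB K) (fun σ a => nextB K σ a ((testsB K σ a).filter fun t => ω t = true)) p.1) ∧ dist1 (GaugeField.plaqHol x (pB K p.2)) ∈ twoSidedShell (θ K p.2) (ρs (levB K p.2)) (ρB K p.2) (c (levB K p.2))}))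
        (fun K => ∑ p : Fin S × τ, ∑ ω : τ → Bool, ((T4GenFunBounds.gibbsMeasure (G := G) Pm β).map (Averaging.iter av K)).real ((⋂ t, (fun V : GaugeField Pm K G => dist1 (GaugeField.plaqHol V (pA K t))) ⁻¹' (if ω t then Iio (θ K t * (1 - ρs (levA K t)) ^ c (levA K t)) else Ici (θ K t * (1 - ρs (levA K t)) ^ c (levA K t)))) ∩ {x | p.2 ∈ testsA K p.1 (Nat.rec (motive := fun _ => α) (aA K) (fun σ a => nextA K σ a ((testsA K σ a).filter fun t => ω t = true)) p.1) ∧ dist1 (GaugeField.plaqHol x (pA K p.2)) ∈ twoSidedShell (θ K p.2) (ρs (levA K p.2)) (ρA K p.2) (c (levA K p.2))}) + ∑ p : Fin S × τ, ∑ ω : τ → Bool, ((T4GenFunBounds.gibbsMeasure (G := G) Pm β).map (Averaging.iter av (K + 1))).real ((⋂ t,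
                (fun V : GaugeField Pm (K + 1) G => dist1 (GaugeField.plaqHol V (pB K t))) ⁻¹' (if ω t then Iio (θ K t * (1 - ρs (levB K t)) ^ c (levB K t)) else Ici (θ K t * (1 - ρs (levB K t)) ^ c (levB K t)))) ∩ {x | p.2 ∈ testsB K p.1
                (Nat.rec (motive := fun _ => α) (aB K) (fun σ a => nextB K σ a ((testsB K σ a).filter fun t => ω t = true)) p.1) ∧ dist1 (GaugeField.plaqHol x (pB K p.2)) ∈ twoSidedShell (θ K p.2) (ρs
                (levB K p.2)) (ρB K p.2) (c (levB K p.2))}))  := by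
  have hη0 : 0 < η := hϑ0.trans hϑη
  have hq0 : 0 ≤ ϑ / η := (div_pos hϑ0 hη0).le
  have hq1 : ϑ / η < 1 := (div_lt_one hη0).mpr hϑη
  have hgeo : ∀ K, ∑ j ∈ Finset.Icc (K - N₁) K, (1 - η)⁻¹ * η⁻¹ ^ j * (2 * ((Finset.Icc j (j + N₁)).card : ℝ) * (((2 * ∏ σ ∈ range S, (ν j σ + 1) - 2 : ℕ) : ℝ)) / n j)
      ≤ ((N₁ + 1) * (M / (1 - η)) * (ϑ / η)⁻¹ ^ N₁) * (ϑ / η) ^ K := fun K => by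
    have h := window_sum_le_geometric_weighted N₁ (fun j => 2 * ((N₁ : ℝ) + 1) * (((2 * ∏ σ ∈ range S, (ν j σ + 1) - 2 : ℕ) : ℝ)) / n j) hϑ0 hϑη.le hη1 hM
      he K
    refine le_trans (le_of_eq (Finset.sum_congr rfl fun j _ => ?_)) h
    rw [card_books]; push_cast; ring
  exact shellWeightBound_averagedRuns_globalAdaptiveTree av β pA pB θ ρA ρB testsA testsB nextA nextB aA aB ρs levA levB ν hβ hiter l₀ n hn
    (fun j => Finset.Icc j (j + N₁)) (fun K => Finset.Icc (K - N₁) K) (fun K j hj => window_books N₁ K j hj) hθ hs0 hs1 hA0 hA2 hB0 hB2 hlevA hlevB hνA hνB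
    (fun j => (1 - η)⁻¹ * η⁻¹ ^ j) (geomLoss_pos hη0 hη1) (geomLoss_sum_inv_lt_one hη0 hη1) hq0 hq1 hgeo

end Rate

end Averaged

/-! ## §3 The member OF RECORD on adaptive trees of (2.17)-type tests on CONSECUTIVE LATTICES of a torus scheme (the cell file 52 left uninstanced) -/

section Scheme

variable {G : Type*} [GaugeGroup G] [MeasurableSpace G] [RegularGaugeGroup G] [HaarData G] {O : Type*} (Sch : Missing.TorusScheme G O)
  {α τ : Type*} [DecidableEq α] [Fintype τ] [DecidableEq τ] {S : ℕ}
  (qA : ∀ K, τ → Plaq (Sch.P K) 0) (qB : ∀ K, τ → Plaq (Sch.P (K + 1)) 0) (θ ρA ρB : ℕ → τ → ℝ) (ρs : ℕ → ℝ) (levA levB : ℕ → τ → ℕ)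
  (testsA testsB : ℕ → ℕ → α → Finset τ) (nextA nextB : ℕ → ℕ → α → Finset τ → α) (aA aB : ℕ → α) (ν : ℕ → ℕ → ℕ)

/-- **THE MEMBER OF RECORD FIRES ON ADAPTIVE TREES OF (2.17)-TYPE TESTS ON CONSECUTIVE LATTICES OF ANY TORUS SCHEME** (the companion of file 50 §5 for the
member of record; file 52 stated no lattice instance).  `Sch` ANY `Missing.TorusScheme G O` with `β_K ≥ 0`; run A = Wilson's Gibbs measure on
`GaugeField (Sch.P K) 0 G`, run B = the same at step `K + 1`; label `t ∈ τ` tests `|U(∂q^X_{K,t}) − 1|` (`GaugeGroup.dist1`) of its plaquette; levels, radii,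
global assignment, per-run adaptive trees and the window bookkeeping exactly as in §2.  Conclusion = file 52's `shellWeightBound_globalAdaptiveTree` BY NAME.
MODEL: the trees are ARBITRARY (node O). [folklore] -/
theorem shellWeightBound_wilsonScheme_globalAdaptiveTree (hβ : ∀ K, 0 ≤ Sch.β K) (l₀ : ℝ) {C ϑ : ℝ} (n : ℕ → ℕ) (hn : ∀ j, 0 < n j)
    (B W : ℕ → Finset ℕ) (hWB : ∀ K j, j ∈ W K → K ∈ B j) (hθ : ∀ K t, 0 ≤ θ K t) (hs0 : ∀ j, 0 ≤ ρs j) (hs1 : ∀ j, ρs j ≤ 1)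
    (hA0 : ∀ K t, 0 ≤ ρA K t) (hA2 : ∀ K t, 2 * ρA K t ≤ ρs (levA K t)) (hB0 : ∀ K t, 0 ≤ ρB K t) (hB2 : ∀ K t, 2 * ρB K t ≤ ρs (levB K t))
    (hlevA : ∀ K t, levA K t ∈ W K) (hlevB : ∀ K t, levB K t ∈ W K)
    (hνA : ∀ K j σ a, ((testsA K σ a).filter fun t => levA K t = j).card ≤ ν j σ)
    (hνB : ∀ K j σ a, ((testsB K σ a).filter fun t => levB K t = j).card ≤ ν j σ)
    (tl : ℕ → ℝ) (htl0 : ∀ j, 0 < tl j) (htl : ∀ J, ∑ j ∈ range J, (tl j)⁻¹ < 1) (hϑ0 : 0 ≤ ϑ) (hϑ1 : ϑ < 1)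
    (hgeo : ∀ K, ∑ j ∈ W K, tl j * (2 * ((B j).card : ℝ) * (((2 * ∏ σ ∈ range S, (ν j σ + 1) - 2 : ℕ) : ℝ)) / n j) ≤ C * ϑ ^ K) :
    ∃ c : ℕ → ℕ, (∀ j, c j < n j) ∧
      T4IndicatorShell.ShellWeightBound l₀ (fun _ => (univ : Finset (τ → Bool)))
        (fun K (_ : ℝ) (ω : τ → Bool) => (T4GenFunBounds.gibbsMeasure (G := G) (Sch.P K) (Sch.β K)).real (⋂ t, (fun U : GaugeField (Sch.P K) 0 G => dist1 (GaugeField.plaqHol U (qA K t))) ⁻¹' (if ω t then Iio (θ K t * (1 - ρs (levA K t)) ^ c (levA K t)) else Ici (θ K t * (1 - ρs (levA K t)) ^ c (levA K t)))))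
        (fun K (_ : ℝ) (ω : τ → Bool) => (T4GenFunBounds.gibbsMeasure (G := G) (Sch.P (K + 1)) (Sch.β (K + 1))).real (⋂ t, (fun U : GaugeField (Sch.P (K + 1)) 0 G => dist1 (GaugeField.plaqHol U (qB K t))) ⁻¹' (if ω t then Iio (θ K t * (1 - ρs (levB K t)) ^ c (levB K t)) else Ici (θ K t * (1 - ρs (levB K t)) ^ c (levB K t)))))
        (fun K (_ : ℝ) (ω : τ → Bool) => (T4GenFunBounds.gibbsMeasure (G := G) (Sch.P K) (Sch.β K)).real ((⋂ t, (fun U : GaugeField (Sch.P K) 0 G => dist1 (GaugeField.plaqHol U (qA K t))) ⁻¹' (if ω t then Iio (θ K t * (1 - ρs (levA K t)) ^ c (levA K t)) else Ici (θ K t * (1 - ρs (levA K t)) ^ c (levA K t)))) ∩ ⋃ p : Fin S × τ, {x | p.2 ∈ testsA K p.1 (Nat.rec (motive := fun _ => α) (aA K) (fun σ a => nextA K σ a ((testsA K σ a).filter fun t => ω t = true)) p.1) ∧ dist1 (GaugeField.plaqHol x (qA K p.2)) ∈ twoSidedShell (θ K p.2) (ρs (levA K p.2)) (ρA K p.2)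 (c (levA K p.2))}))
        (fun K (_ : ℝ) (ω : τ → Bool) => (T4GenFunBounds.gibbsMeasure (G := G) (Sch.P (K + 1)) (Sch.β (K + 1))).real ((⋂ t, (fun U : GaugeField (Sch.P (K + 1)) 0 G => dist1 (GaugeField.plaqHol U (qB K t))) ⁻¹' (if ω t then Iio (θ K t * (1 - ρs (levB K t)) ^ c (levB K t)) else Ici (θ K t * (1 - ρs (levB K t)) ^ c (levB K t)))) ∩ ⋃ p : Fin S × τ, {x | p.2 ∈ testsB K p.1 (Nat.rec (motive := fun _ => α) (aB K) (fun σ a => nextB K σ a ((testsB K σ a).filter fun t => ω t = true)) p.1) ∧ dist1 (GaugeField.plaqHol x (qB K p.2)) ∈ twoSidedShell (θ K p.2) (ρs (levB K p.2)) (ρB K p.2) (c (levB K p.2))}))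
        (fun K => ∑ p : Fin S × τ, ∑ ω : τ → Bool, (T4GenFunBounds.gibbsMeasure (G := G) (Sch.P K) (Sch.β K)).real ((⋂ t, (fun U : GaugeField (Sch.P K) 0 G => dist1 (GaugeField.plaqHol U (qA K t))) ⁻¹' (if ω t then Iio (θ K t * (1 - ρs (levA K t)) ^ c (levA K t)) else Ici (θ K t * (1 - ρs (levA K t)) ^ c (levA K t)))) ∩ {x | p.2 ∈ testsA K p.1 (Nat.rec (motive := fun _ => α) (aA K) (fun σ a => nextA K σ a ((testsA K σ a).filter fun t => ω t = true)) p.1) ∧ dist1 (GaugeField.plaqHol x (qA K p.2)) ∈ twoSidedShell (θ K p.2) (ρs (levA K p.2)) (ρA K p.2) (c (levA K p.2))}) + ∑ p : Fin S × τ, ∑ ω : τ → Bool, (T4GenFunBounds.gibbsMeasure (G := G) (Sch.P (K + 1)) (Sch.β (K + 1))).real ((⋂ t,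
                (fun U : GaugeField (Sch.P (K + 1)) 0 G => dist1 (GaugeField.plaqHol U (qB K t))) ⁻¹' (if ω t then Iio (θ K t * (1 - ρs (levB K t)) ^ c (levB K t)) else Ici (θ K t * (1 - ρs (levB K t)) ^ c (levB K t)))) ∩ {x | p.2 ∈ testsB K p.1
                (Nat.rec (motive := fun _ => α) (aB K) (fun σ a => nextB K σ a ((testsB K σ a).filter fun t => ω t = true)) p.1) ∧ dist1 (GaugeField.plaqHol x (qB K p.2)) ∈ twoSidedShell (θ K p.2) (ρs
                (levB K p.2)) (ρB K p.2) (c (levB K p.2))}))  := by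
  haveI : ∀ K, IsProbabilityMeasure (T4GenFunBounds.gibbsMeasure (G := G) (Sch.P K) (Sch.β K)) := fun K => T4GenFunBounds.isProbabilityMeasure_gibbsMeasure _ (hβ K)
  haveI : ∀ K, IsProbabilityMeasure (T4GenFunBounds.gibbsMeasure (G := G) (Sch.P (K + 1)) (Sch.β (K + 1))) := fun K =>
    T4GenFunBounds.isProbabilityMeasure_gibbsMeasure _ (hβ (K + 1))
  exact shellWeightBound_globalAdaptiveTree (S := S) (ΩA := fun K => GaugeField (Sch.P K) 0 G) (ΩB := fun K => GaugeField (Sch.P (K + 1)) 0 G)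
    (fun K => T4GenFunBounds.gibbsMeasure (G := G) (Sch.P K) (Sch.β K)) (fun K => T4GenFunBounds.gibbsMeasure (G := G) (Sch.P (K + 1)) (Sch.β (K + 1)))
    (fun K t (U : GaugeField (Sch.P K) 0 G) => dist1 (GaugeField.plaqHol U (qA K t)))
    (fun K t (U : GaugeField (Sch.P (K + 1)) 0 G) => dist1 (GaugeField.plaqHol U (qB K t))) θ ρA ρB ρs levA levB testsA testsB nextA nextB aA aB ν
    l₀ n hn B W hWB
    (fun K t => RegularGaugeGroup.measurable_dist1.comp (Missing.measurable_plaqHol (qA K t)))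
    (fun K t => RegularGaugeGroup.measurable_dist1.comp (Missing.measurable_plaqHol (qB K t)))
    hθ hs0 hs1 hA0 hA2 hB0 hB2 hlevA hlevB hνA hνB tl htl0 htl hϑ0 hϑ1 hgeo

end Scheme

end Summit.QuantumFields.BalabanUV.T4Continuum.Spine.NE7c.LiveFactorAveragedRunsGlobalAdaptiveModel

end
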